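import Summits.ValiantsHypothesis.ValiantsHypothesis.Theorems.SymmetroidPencilBasics
import Summits.ValiantsHypothesis.ValiantsHypothesis.Theorems.LacunarySymmetroidMatrixDescartesDoorA26WallBubblingBubblingNormalisation
import Summits.ValiantsHypothesis.ValiantsHypothesis.Theorems.LacunarySymmetroidMatrixDescartesTailGraft

/-!
# `DoorA26`, negative side — un-nulling an end letter of a `(2,6)` pencil: the perturbation `S_i ↦ S_i + η·1` and the leading-term asymptotics

HONEST FRAMING.  Helper lemmas (def-free, `--supports 19979 --as helper`) for the negative-side file `Theorems/DoorA26/Negative/DoorA26FalseOfNullNullEighteen.lean` (crux stmt-ValiantsHypothesis-19979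
`DoorA26`; OPEN, typed, never asserted); W2 seat val-sym-door-p1 g16.  Contents (with `TailGraft.det_add_smul_one_two`: `det (M + c•1) = det M + c·tr M + c²`): the pencil with one letter
replaced by `S_i + η·1` (evaluation, determinant as a quadratic in `η`, continuity, symmetry); the leading-term asymptotics of `det P(t)` at `t → ∞`
(`/ t^{2d₅} → det S₅`) and at `t → 0⁺` (`/ t^{2d₀} → det S₀`) for strictly increasing exponents; two sign-bookkeeping lemmas.  Nothing here bears on
`DoorA26`, `MatrixDescartes` (stmt-ValiantsHypothesis-18050) or `VP ≠ VNP`.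

[folklore] elementary.
-/

-- `Summit.ValiantsHypothesis.ValiantsHypothesis.…` repeats a component by the D-0017 layout
-- (single-conjunct summit), which the `dupNamespace` linter flags; the name is mandated.
set_option linter.dupNamespace false

namespace Summit.ValiantsHypothesis.ValiantsHypothesis.Theorems.LacunarySymmetroidMatrixDescartes.NullEnd

open Polynomial Finset Filter Topology
open scoped BigOperators Matrix
open Summit.ValiantsHypothesis.ValiantsHypothesis.Theorems.SymmetroidDescartes (eval_det_pencil le_card_posRoots_of_alternating)
open Summit.ValiantsHypothesis.ValiantsHypothesis.Theorems.LacunarySymmetroidMatrixDescartes.WallBubbling.Bubbling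
  (polar polar_self det_sum_smul_fin_two)

/-! ### The perturbation `S_i ↦ S_i + η·1` of one letter -/

/-- The pencil with letter `i` replaced by `S i + η·1`, evaluated at `t`, is the old matrix plus `η t^{d i}·1`. [folklore] -/
theorem pencil_update_eval (d : Fin 6 → ℕ) (S : Fin 6 → Matrix (Fin 2) (Fin 2) ℝ) (i : Fin 6) (η t : ℝ) :
    (∑ l, t ^ d l • Function.update S i (S i + η • (1 : Matrix (Fin 2) (Fin 2) ℝ)) l)
      = (∑ l, t ^ d l • S l) + (η * t ^ d i) • (1 : Matrix (Fin 2) (Fin 2) ℝ) := by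
  have : ∀ l, t ^ d l • Function.update S i (S i + η • (1 : Matrix (Fin 2) (Fin 2) ℝ)) l
      = t ^ d l • S l + (if l = i then (η * t ^ d i) • (1 : Matrix (Fin 2) (Fin 2) ℝ) else 0) := by
    intro l
    by_cases h : l = i
    · subst h
      simp only [Function.update_self, smul_add, if_true, smul_smul]
      ring_nf
    · simp only [Function.update_of_ne h, if_neg h, add_zero]
  simp_rw [this, Finset.sum_add_distrib, Finset.sum_ite_eq' Finset.univ i, if_pos (Finset.mem_univ _)]

/-- The perturbed determinant at a fixed abscissa is a quadratic polynomial in `η`, hence continuous. [folklore] -/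
theorem det_pencil_update_eq (d : Fin 6 → ℕ) (S : Fin 6 → Matrix (Fin 2) (Fin 2) ℝ) (i : Fin 6) (η t : ℝ) :
    (∑ l, t ^ d l • Function.update S i (S i + η • (1 : Matrix (Fin 2) (Fin 2) ℝ)) l).det
      = (∑ l, t ^ d l • S l).det + (η * t ^ d i) * (∑ l, t ^ d l • S l).trace + (η * t ^ d i) ^ 2 := by
  rw [pencil_update_eval, LacunarySymmetroidMatrixDescartes.TailGraft.det_add_smul_one_two]

/-- The perturbed determinant at a fixed abscissa depends continuously on `η`. [folklore] -/
theorem continuous_det_pencil_update (d : Fin 6 → ℕ) (S : Fin 6 → Matrix (Fin 2) (Fin 2) ℝ) (i : Fin 6) (t : ℝ) :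
    Continuous fun η : ℝ => (∑ l, t ^ d l • Function.update S i (S i + η • (1 : Matrix (Fin 2) (Fin 2) ℝ)) l).det := by
  simp_rw [det_pencil_update_eq]
  fun_prop

/-- The updated letters are symmetric. [folklore] -/
theorem isSymm_update (S : Fin 6 → Matrix (Fin 2) (Fin 2) ℝ) (hS : ∀ l, (S l).IsSymm) (i : Fin 6) (η : ℝ) (l : Fin 6) :
    (Function.update S i (S i + η • (1 : Matrix (Fin 2) (Fin 2) ℝ)) l).IsSymm := by
  by_cases h : l = i
  · subst h
    rw [Function.update_self]
    exact (hS l).add (Matrix.isSymm_one.smul η)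
  · rw [Function.update_of_ne h]; exact hS l

/-! ### Leading-term asymptotics at `t → ∞` and `t → 0⁺` -/

/-- **Top asymptotics.**  With strictly increasing exponents, `det P(t) / t^{2 d₅} → det S₅` as `t → ∞`. [folklore] -/
theorem tendsto_det_pencil_div_top (d : Fin 6 → ℕ) (hd : StrictMono d) (S : Fin 6 → Matrix (Fin 2) (Fin 2) ℝ) :
    Tendsto (fun t : ℝ => (∑ l, t ^ d l • S l).det / t ^ (2 * d 5)) atTop (𝓝 ((S 5).det)) := by
  have hexp : ∀ k l : Fin 6, (k, l) ≠ ((5 : Fin 6), (5 : Fin 6)) → d k + d l < 2 * d 5 := by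
    intro k l hkl
    have hk : d k ≤ d 5 := hd.monotone (Fin.le_last k)
    have hl : d l ≤ d 5 := hd.monotone (Fin.le_last l)
    rcases lt_or_eq_of_le hk with hk' | hk'
    · omega
    · have : k = 5 := hd.injective hk'
      subst this
      rcases lt_or_eq_of_le hl with hl' | hl'
      · omega
      · exact (hkl (by rw [hd.injective hl'])).elim
  -- term-wise limits
  have hterm : ∀ k l : Fin 6, Tendsto (fun t : ℝ => t ^ d k * t ^ d l * polar (S k) (S l) / t ^ (2 * d 5)) atTop
      (𝓝 (if (k, l) = ((5 : Fin 6), (5 : Fin 6)) then polar (S k) (S l) else 0)) := by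
    intro k l
    by_cases hkl : (k, l) = ((5 : Fin 6), (5 : Fin 6))
    · rw [if_pos hkl]
      obtain ⟨hk5, hl5⟩ := Prod.ext_iff.mp hkl
      simp only at hk5 hl5
      subst hk5; subst hl5
      have : (fun t : ℝ => t ^ d 5 * t ^ d 5 * polar (S 5) (S 5) / t ^ (2 * d 5))
          =ᶠ[atTop] fun _ => polar (S 5) (S 5) := by
        filter_upwards [eventually_gt_atTop 0] with t ht
        rw [← pow_add, show d 5 + d 5 = 2 * d 5 by ring]
        field_simp
      exact Tendsto.congr' this.symm tendsto_const_nhds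
    · rw [if_neg hkl]
      have hlt := hexp k l hkl
      have : (fun t : ℝ => t ^ d k * t ^ d l * polar (S k) (S l) / t ^ (2 * d 5))
          =ᶠ[atTop] fun t => polar (S k) (S l) * (t ^ (2 * d 5 - (d k + d l)))⁻¹ := by
        filter_upwards [eventually_gt_atTop 0] with t ht
        have hsplit : t ^ (2 * d 5) = t ^ (d k + d l) * t ^ (2 * d 5 - (d k + d l)) := by
          rw [← pow_add]; congr 1; omega
        rw [hsplit, ← pow_add]
        have h1 : t ^ (d k + d l) ≠ 0 := pow_ne_zero _ ht.ne'
        have h2 : t ^ (2 * d 5 - (d k + d l)) ≠ 0 := pow_ne_zero _ ht.ne'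
        field_simp
      refine Tendsto.congr' this.symm ?_
      have h0 : Tendsto (fun t : ℝ => (t ^ (2 * d 5 - (d k + d l)))⁻¹) atTop (𝓝 0) :=
        tendsto_inv_atTop_zero.comp (tendsto_pow_atTop (by omega))
      simpa using h0.const_mul (polar (S k) (S l))
  have hsum := tendsto_finsetSum Finset.univ fun k (_ : k ∈ Finset.univ) =>
    tendsto_finsetSum Finset.univ fun l (_ : l ∈ Finset.univ) => hterm k l
  have hlim : (∑ k : Fin 6, ∑ l : Fin 6, if (k, l) = ((5 : Fin 6), (5 : Fin 6)) then polar (S k) (S l) else (0 : ℝ)) = (S 5).det := by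
    rw [Finset.sum_eq_single (5 : Fin 6), Finset.sum_eq_single (5 : Fin 6)]
    · simp [polar_self]
    · intro l _ hl; rw [if_neg]; exact fun h => hl (Prod.ext_iff.mp h).2
    · simp
    · intro k _ hk
      exact Finset.sum_eq_zero fun l _ => by rw [if_neg]; exact fun h => hk (Prod.ext_iff.mp h).1
    · simp
  rw [hlim] at hsum
  refine hsum.congr' (Eventually.of_forall fun t => ?_)
  simp only
  rw [det_sum_smul_fin_two, Finset.sum_div]
  simp_rw [Finset.sum_div]

/-- **Bottom asymptotics.**  With strictly increasing exponents, `det P(t) / t^{2 d₀} → det S₀` as `t → 0⁺`. [folklore] -/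
theorem tendsto_det_pencil_div_bot (d : Fin 6 → ℕ) (hd : StrictMono d) (S : Fin 6 → Matrix (Fin 2) (Fin 2) ℝ) :
    Tendsto (fun t : ℝ => (∑ l, t ^ d l • S l).det / t ^ (2 * d 0)) (𝓝[>] 0) (𝓝 ((S 0).det)) := by
  have hexp : ∀ k l : Fin 6, (k, l) ≠ ((0 : Fin 6), (0 : Fin 6)) → 2 * d 0 < d k + d l := by
    intro k l hkl
    have hk : d 0 ≤ d k := hd.monotone (Fin.zero_le k)
    have hl : d 0 ≤ d l := hd.monotone (Fin.zero_le l)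
    rcases lt_or_eq_of_le hk with hk' | hk'
    · omega
    · have : k = 0 := (hd.injective hk').symm
      subst this
      rcases lt_or_eq_of_le hl with hl' | hl'
      · omega
      · exact (hkl (by rw [(hd.injective hl').symm])).elim
  have hterm : ∀ k l : Fin 6, Tendsto (fun t : ℝ => t ^ d k * t ^ d l * polar (S k) (S l) / t ^ (2 * d 0)) (𝓝[>] 0)
      (𝓝 (if (k, l) = ((0 : Fin 6), (0 : Fin 6)) then polar (S k) (S l) else 0)) := by
    intro k l
    by_cases hkl : (k, l) = ((0 : Fin 6), (0 : Fin 6))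
    · rw [if_pos hkl]
      obtain ⟨hk5, hl5⟩ := Prod.ext_iff.mp hkl
      simp only at hk5 hl5
      subst hk5; subst hl5
      have : (fun t : ℝ => t ^ d 0 * t ^ d 0 * polar (S 0) (S 0) / t ^ (2 * d 0))
          =ᶠ[𝓝[>] 0] fun _ => polar (S 0) (S 0) := by
        filter_upwards [self_mem_nhdsWithin] with t ht
        rw [← pow_add, show d 0 + d 0 = 2 * d 0 by ring]
        have : t ^ (2 * d 0) ≠ 0 := pow_ne_zero _ (ne_of_gt ht)
        field_simp
      exact Tendsto.congr' this.symm tendsto_const_nhds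
    · rw [if_neg hkl]
      have hlt := hexp k l hkl
      have : (fun t : ℝ => t ^ d k * t ^ d l * polar (S k) (S l) / t ^ (2 * d 0))
          =ᶠ[𝓝[>] 0] fun t => polar (S k) (S l) * t ^ (d k + d l - 2 * d 0) := by
        filter_upwards [self_mem_nhdsWithin] with t ht
        have hsplit : t ^ (d k + d l) = t ^ (2 * d 0) * t ^ (d k + d l - 2 * d 0) := by
          rw [← pow_add]; congr 1; omega
        rw [← pow_add, hsplit]
        have h1 : t ^ (2 * d 0) ≠ 0 := pow_ne_zero _ (ne_of_gt ht)
        field_simp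
      refine Tendsto.congr' this.symm ?_
      have h0 : Tendsto (fun t : ℝ => t ^ (d k + d l - 2 * d 0)) (𝓝[>] 0) (𝓝 0) := by
        have : Tendsto (fun t : ℝ => t ^ (d k + d l - 2 * d 0)) (𝓝 0) (𝓝 (0 ^ (d k + d l - 2 * d 0))) :=
          (continuous_pow _).tendsto 0
        rw [zero_pow (by omega)] at this
        exact this.mono_left nhdsWithin_le_nhds
      simpa using h0.const_mul (polar (S k) (S l))
  have hsum := tendsto_finsetSum Finset.univ fun k (_ : k ∈ Finset.univ) =>
    tendsto_finsetSum Finset.univ fun l (_ : l ∈ Finset.univ) => hterm k l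
  have hlim : (∑ k : Fin 6, ∑ l : Fin 6, if (k, l) = ((0 : Fin 6), (0 : Fin 6)) then polar (S k) (S l) else (0 : ℝ)) = (S 0).det := by
    rw [Finset.sum_eq_single (0 : Fin 6), Finset.sum_eq_single (0 : Fin 6)]
    · simp [polar_self]
    · intro l _ hl; rw [if_neg]; exact fun h => hl (Prod.ext_iff.mp h).2
    · simp
    · intro k _ hk
      exact Finset.sum_eq_zero fun l _ => by rw [if_neg]; exact fun h => hk (Prod.ext_iff.mp h).1
    · simp
  rw [hlim] at hsum
  refine hsum.congr' (Eventually.of_forall fun t => ?_)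
  simp only
  rw [det_sum_smul_fin_two, Finset.sum_div]
  simp_rw [Finset.sum_div]

/-! ### Sign bookkeeping -/

/-- From `a a' > 0`, `b b' > 0`, `a b < 0` conclude `a' b' < 0`. [folklore] -/
theorem neg_of_sign_transfer {a a' b b' : ℝ} (h1 : 0 < a * a') (h2 : 0 < b * b') (h3 : a * b < 0) : a' * b' < 0 := by
  rcases lt_trichotomy a 0 with ha | ha | ha
  · have ha' : a' < 0 := by nlinarith
    have hb : 0 < b := by nlinarith
    have hb' : 0 < b' := by nlinarith
    nlinarith
  · subst ha; simp at h1
  · have ha' : 0 < a' := by nlinarith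
    have hb : b < 0 := by nlinarith
    have hb' : b' < 0 := by nlinarith
    nlinarith

/-- From `a a' > 0`, `D a < 0`, `b D > 0` conclude `a' b < 0`. [folklore] -/
theorem neg_of_sign_chain {a a' D b : ℝ} (h1 : 0 < a * a') (h2 : D * a < 0) (h3 : 0 < b * D) : a' * b < 0 := by
  rcases lt_trichotomy a 0 with ha | ha | ha
  · have ha' : a' < 0 := by nlinarith
    have hD : 0 < D := by nlinarith
    have hb : 0 < b := by nlinarith
    nlinarith
  · subst ha; simp at h1
  · have ha' : 0 < a' := by nlinarith
    have hD : D < 0 := by nlinarith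
    have hb : b < 0 := by nlinarith
    nlinarith

end Summit.ValiantsHypothesis.ValiantsHypothesis.Theorems.LacunarySymmetroidMatrixDescartes.NullEnd
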